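import Summits.NavierStokesRegularity.NavierStokesRegularity.Theorems.PoloidalWindowDoorPoloidalWindowRigidityZShockNoLocalizedBreather
import Literature.Analysis.FluidPDE.HarmonicLiouvilleLp
import HarnessLib

/-!
# Crux K2 `PoloidalWindowRigidity` (stmt-NavierStokesRegularity-19708), line `z_shock` — the localised breather is TRIVIAL: `w ≡ w⋆` AND `u ≡ 0`

`--supports stmt-NavierStokesRegularity-19708 --as helper` (leafhand-ns-poloidalwindowdoor-3 g11, cell decomp-ns, 2026-08-31).  Def-free; sequel of
`…ZShockNoLocalizedBreather` (p833692) closing its last clause with the tree's `Lᵖ` harmonic Liouville theorem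
(`Literature.Analysis.FluidPDE.eq_zero_of_harmonic_memLp`).  **No stub and no summit is closed by this file; Navier–Stokes regularity is NOT
proved here (rung 0).**

* `laplacian_eq_zero_of_div_curl_free` — a `C²` pair `(U₀, U₁)` on `ℝ²` with `∂₀U₀ + ∂₁U₁ = 0` and `∂₁U₀ = ∂₀U₁` has harmonic components
  (`ΔU₀ = −∂₀∂₁U₁ + ∂₁∂₀U₁ = 0`, `ΔU₁ = ∂₀∂₁U₀ − ∂₁∂₀U₀ = 0`, symmetry of second derivatives);
* `eq_zero_of_div_curl_free_of_sq_integrable` — if moreover `∫(U₀² + U₁²) < ∞` then `U ≡ 0` (harmonic + `L²` ⇒ `0`);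
* ★ `no_localized_breather_trivial` — in the setting of `no_localized_breather` (autonomous height-evolution on a uniformly hyperbolic column,
  `P`-periodic in the height, horizontal energy `∫(|u|² + (w − w⋆)²) ≤ B` at every height): `w ≡ w⋆` AND `u ≡ 0`.  The localised breather family of
  the R3 inhabitant census is EMPTY (not merely frozen). [folklore]
-/

noncomputable section

namespace Summit.NavierStokesRegularity.NavierStokesRegularity.Theorems.PoloidalWindowDoorPoloidalWindowRigidityZShockNoLocalizedBreatherTrivial

-- the summit and its single sub-problem share the name (CONVENTIONS §1)
set_option linter.dupNamespace false

open Set Filter Topology Function MeasureTheory Metric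
open scoped ContDiff ENNReal Laplacian
open Summit.NavierStokesRegularity.NavierStokesRegularity.Theorems.PoloidalWindowDoorPoloidalWindowRigidityZShockLocalEnergy
open Summit.NavierStokesRegularity.NavierStokesRegularity.Theorems.PoloidalWindowDoorPoloidalWindowRigidityZShockNoLocalizedBreather

/-! ### Div- and curl-free planar fields are harmonic -/

/-- The Laplacian of a scalar `C²` function on `ℝ²` in coordinates: `Δf(y) = ∂₀(∂₀f)(y) + ∂₁(∂₁f)(y)`. [folklore] -/
theorem laplacian_eq_two {f : EuclideanSpace ℝ (Fin 2) → ℝ} (hf : ContDiff ℝ 2 f) (y : EuclideanSpace ℝ (Fin 2)) :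
    (Δ f) y = fderiv ℝ (fun z => fderiv ℝ f z (EuclideanSpace.single 0 1)) y (EuclideanSpace.single 0 1) +
      fderiv ℝ (fun z => fderiv ℝ f z (EuclideanSpace.single 1 1)) y (EuclideanSpace.single 1 1) := by
  have hG : DifferentiableAt ℝ (fderiv ℝ f) y := ((hf.fderiv_right (m := 1) le_rfl).differentiable one_ne_zero) y
  rw [congrFun (InnerProductSpace.laplacian_eq_iteratedFDeriv_orthonormalBasis f (EuclideanSpace.basisFun (Fin 2) ℝ)) y,
    Fin.sum_univ_two]
  simp only [iteratedFDeriv_two_apply, EuclideanSpace.basisFun_apply]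
  rw [fderiv_clm_apply hG (differentiableAt_const _), fderiv_clm_apply hG (differentiableAt_const _)]
  simp

/-- Second derivatives of a `C²` scalar function commute (coordinate form). [folklore] -/
theorem fderiv_fderiv_comm {f : EuclideanSpace ℝ (Fin 2) → ℝ} (hf : ContDiff ℝ 2 f) (y h k : EuclideanSpace ℝ (Fin 2)) :
    fderiv ℝ (fun z => fderiv ℝ f z h) y k = fderiv ℝ (fun z => fderiv ℝ f z k) y h := by
  have hG : DifferentiableAt ℝ (fderiv ℝ f) y := ((hf.fderiv_right (m := 1) le_rfl).differentiable one_ne_zero) y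
  rw [fderiv_clm_apply hG (differentiableAt_const _), fderiv_clm_apply hG (differentiableAt_const _)]
  simp only [fderiv_fun_const, Pi.zero_apply, ContinuousLinearMap.comp_zero, zero_add, ContinuousLinearMap.flip_apply]
  exact (hf.contDiffAt.isSymmSndFDerivAt (by simp)) k h

/-- **Div- and curl-free planar `C²` fields have harmonic components.** [folklore] -/
theorem laplacian_eq_zero_of_div_curl_free {U₀ U₁ : EuclideanSpace ℝ (Fin 2) → ℝ} (h0 : ContDiff ℝ 2 U₀) (h1 : ContDiff ℝ 2 U₁)
    (hdiv : ∀ y, fderiv ℝ U₀ y (EuclideanSpace.single 0 1) + fderiv ℝ U₁ y (EuclideanSpace.single 1 1) = 0)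
    (hcurl : ∀ y, fderiv ℝ U₀ y (EuclideanSpace.single 1 1) = fderiv ℝ U₁ y (EuclideanSpace.single 0 1)) :
    (∀ y, (Δ U₀) y = 0) ∧ (∀ y, (Δ U₁) y = 0) := by
  have e00 : (fun z => fderiv ℝ U₀ z (EuclideanSpace.single 0 1)) = fun z => -fderiv ℝ U₁ z (EuclideanSpace.single 1 1) :=
    funext fun z => by linarith [hdiv z]
  have e01 : (fun z => fderiv ℝ U₀ z (EuclideanSpace.single 1 1)) = fun z => fderiv ℝ U₁ z (EuclideanSpace.single 0 1) :=
    funext fun z => hcurl z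
  have e10 : (fun z => fderiv ℝ U₁ z (EuclideanSpace.single 0 1)) = fun z => fderiv ℝ U₀ z (EuclideanSpace.single 1 1) :=
    funext fun z => (hcurl z).symm
  have e11 : (fun z => fderiv ℝ U₁ z (EuclideanSpace.single 1 1)) = fun z => -fderiv ℝ U₀ z (EuclideanSpace.single 0 1) :=
    funext fun z => by linarith [hdiv z]
  constructor
  · intro y
    rw [laplacian_eq_two h0, e00, e01, fderiv_fun_neg, _root_.neg_apply,
      fderiv_fderiv_comm h1 y (EuclideanSpace.single 1 1) (EuclideanSpace.single 0 1)]
    ring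
  · intro y
    rw [laplacian_eq_two h1, e10, e11, fderiv_fun_neg, _root_.neg_apply,
      fderiv_fderiv_comm h0 y (EuclideanSpace.single 1 1) (EuclideanSpace.single 0 1)]
    ring

/-- **A div- and curl-free planar `C²` field of finite energy vanishes** (harmonic components in `L²`). [folklore] -/
theorem eq_zero_of_div_curl_free_of_sq_integrable {U₀ U₁ : EuclideanSpace ℝ (Fin 2) → ℝ} (h0 : ContDiff ℝ 2 U₀) (h1 : ContDiff ℝ 2 U₁)
    (hdiv : ∀ y, fderiv ℝ U₀ y (EuclideanSpace.single 0 1) + fderiv ℝ U₁ y (EuclideanSpace.single 1 1) = 0)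
    (hcurl : ∀ y, fderiv ℝ U₀ y (EuclideanSpace.single 1 1) = fderiv ℝ U₁ y (EuclideanSpace.single 0 1))
    (hint : Integrable fun y => U₀ y ^ 2 + U₁ y ^ 2) :
    (∀ y, U₀ y = 0) ∧ (∀ y, U₁ y = 0) := by
  obtain ⟨hΔ0, hΔ1⟩ := laplacian_eq_zero_of_div_curl_free h0 h1 hdiv hcurl
  have hc0 : Continuous U₀ := h0.continuous
  have hc1 : Continuous U₁ := h1.continuous
  have hi0 : Integrable fun y => U₀ y ^ 2 :=
    hint.mono' (hc0.pow 2).aestronglyMeasurable (Eventually.of_forall fun y => by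
      rw [Real.norm_eq_abs, abs_of_nonneg (sq_nonneg _)]; nlinarith [sq_nonneg (U₁ y)])
  have hi1 : Integrable fun y => U₁ y ^ 2 :=
    hint.mono' (hc1.pow 2).aestronglyMeasurable (Eventually.of_forall fun y => by
      rw [Real.norm_eq_abs, abs_of_nonneg (sq_nonneg _)]; nlinarith [sq_nonneg (U₀ y)])
  have hm0 : MemLp U₀ 2 := (memLp_two_iff_integrable_sq hc0.aestronglyMeasurable).2 hi0
  have hm1 : MemLp U₁ 2 := (memLp_two_iff_integrable_sq hc1.aestronglyMeasurable).2 hi1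
  have hz0 := Literature.Analysis.FluidPDE.eq_zero_of_harmonic_memLp
    (Literature.Analysis.FluidPDE.harmonicOnNhd_of_laplacian_eq_zero h0 hΔ0) (q := 2) (by norm_num) (by simp) hm0
  have hz1 := Literature.Analysis.FluidPDE.eq_zero_of_harmonic_memLp
    (Literature.Analysis.FluidPDE.harmonicOnNhd_of_laplacian_eq_zero h1 hΔ1) (q := 2) (by norm_num) (by simp) hm1
  exact ⟨fun y => by simpa using congrFun hz0 y, fun y => by simpa using congrFun hz1 y⟩

/-! ### The breather is trivial -/

variable {u : Fin 2 → ℝ → EuclideanSpace ℝ (Fin 2) → ℝ} {w : ℝ → EuclideanSpace ℝ (Fin 2) → ℝ} {G Θ : ℝ → ℝ} {wstar P γlo γhi B : ℝ}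

/-- ★ **The localised breather is trivial**: in the setting of `no_localized_breather`, `w ≡ w⋆` and `u ≡ 0`. [folklore] -/
theorem no_localized_breather_trivial (hu : ∀ i, ContDiff ℝ ∞ (uncurry (u i))) (hw : ContDiff ℝ ∞ (uncurry w))
    (hΘs : ContDiff ℝ ∞ Θ) (hΘ : ∀ r, HasDerivAt Θ ((r - wstar) * G r) r) (hΘ0 : Θ wstar = 0)
    (hγlo : 0 < γlo) (hGlo : ∀ r, G r ≤ -γlo) (hGhi : ∀ r, -γhi ≤ G r)
    (hus : ∀ i s y, HasDerivAt (fun s' => u i s' y) (G (w s y) * fderiv ℝ (w s) y (EuclideanSpace.single i 1)) s)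
    (hws : ∀ s y, HasDerivAt (fun s' => w s' y)
      (-(fderiv ℝ (u 0 s) y (EuclideanSpace.single 0 1) + fderiv ℝ (u 1 s) y (EuclideanSpace.single 1 1))) s)
    (hpol : ∀ s y, fderiv ℝ (u 0 s) y (EuclideanSpace.single 1 1) = fderiv ℝ (u 1 s) y (EuclideanSpace.single 0 1))
    (hP : 0 < P) (hPu : ∀ i s y, u i (s + P) y = u i s y) (hPw : ∀ s y, w (s + P) y = w s y)
    (hint : ∀ s, Integrable fun y => u 0 s y ^ 2 + u 1 s y ^ 2 + (w s y - wstar) ^ 2)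
    (hB : ∀ s, ∫ y, (u 0 s y ^ 2 + u 1 s y ^ 2 + (w s y - wstar) ^ 2) ≤ B) :
    (∀ s y, w s y = wstar) ∧ (∀ i s y, u i s y = 0) := by
  obtain ⟨hwc, -, hdiv⟩ := no_localized_breather_frozen hu hw hΘs hΘ hΘ0 hγlo hGlo hGhi hus hws hpol hP hPu hPw hint hB
  refine ⟨hwc, ?_⟩
  have key : ∀ s, (∀ y, u 0 s y = 0) ∧ (∀ y, u 1 s y = 0) := by
    intro s
    have h0 : ContDiff ℝ 2 (u 0 s) := (contDiff_slice (hu 0) s).of_le (by norm_cast)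
    have h1 : ContDiff ℝ 2 (u 1 s) := (contDiff_slice (hu 1) s).of_le (by norm_cast)
    have hint' : Integrable fun y => u 0 s y ^ 2 + u 1 s y ^ 2 := by
      refine (hint s).congr (Eventually.of_forall fun y => ?_)
      simp [hwc s y]
    exact eq_zero_of_div_curl_free_of_sq_integrable h0 h1 (hdiv s) (hpol s) hint'
  intro i s y
  fin_cases i
  · exact (key s).1 y
  · exact (key s).2 y

end Summit.NavierStokesRegularity.NavierStokesRegularity.Theorems.PoloidalWindowDoorPoloidalWindowRigidityZShockNoLocalizedBreatherTrivial

end
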